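import Summits.HodgeConjecture.HodgeConjecture.Theses.NikulinTwinTransport

/-!
# `TwinTwistorTransport` (stmt-HodgeConjecture-14393, typed rev-7 form) · Negative · without (R) or without (H) the crux is the diagonal

Load-bearing analysis ON THE REAL CARRIERS for the typed OUTPUT form of the crux
`TwinTwistorTransport` (route NikulinTwinTransport, r4): "for every projective K3 surface `S` there
are a projective K3 `S″` and an algebraic `ℂ`-linear equivalence `Ψ : H²(S″) ≃ H²(S)` with
(R) `Ψ⁻¹` rational, (T) `Ψ⁻¹` type-preserving, (H) `u.v = 2b·p ⟹ Ψ⁻¹u.Ψ⁻¹v = b·p″`,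
(A) `Ψ = fst_*(snd^*(–) ∪ γ)`, `γ ∈ algebraicClasses (S ⊗ S″) 2`".

Both theorems take as hypothesis the DIAGONAL CLASS (Fulton 1998 Prop. 16.1.1 / Ex. 16.1.2: an
algebraic `Δ ∈ algebraicClasses (S ⊗ S) 2` with `fst_*(snd^* x ∪ Δ) = x`; a standard fact about the
tree's `complexGysin`/`cupProduct`/`algebraicClasses`, not yet proved in the tree, INLINED here as a
hypothesis — no named fact is introduced) and conclude the crux with ONE clause deleted, everything
else verbatim:

* `withoutR_of_diagonalClass` — delete (R): witness `S″ = S`, `p″ = p`, `Ψ = c • id`, `c² = 2`.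
  (T) holds because `IsOfHodgeType` is `∃ A : HodgeModel` and each `A.hodgePQ` is a `ℂ`-submodule;
  (H) by bilinearity of `cupProduct`; (A) with `γ = c • Δ` because `algebraicClasses` is a
  `ℂ`-submodule and `complexGysin`, `cupProduct` are `ℂ`-linear.  So `IsRationalClass` is the ONLY
  clause not closed under `c ∈ ℂˣ`: every proof of the crux uses (R) essentially, and uses that the
  rational classes form a genuine `ℚ`-structure.
* `withoutH_of_diagonalClass` — delete (H): witness `Ψ = id`.  So the multiplier clause is equally
  load-bearing; modulo `[Δ]_* = id` the content of the crux is exactly the CONJUNCTION (R) ∧ (H): a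
  RATIONAL algebraic correspondence into `H²(S)` which is ALSO a 2-similitude (never a multiple of the
  diagonal: `halving_id_forces_zero`, `no_self_twoSimilitude_of_odd` in the sibling Negative files).
Neither theorem asserts a Theses decl; both are sorry-free on the real carriers.
Refuter seat refuter-cdisprove-stmt-HodgeConjecture-14393-0 (gen 1, typed form), 2026-08-16; work file
`Cruxes/TwinTwistorTransport/Disproof.lean` §T1′/T2′ (where the two weakened statements are named
`TwinTwistorTransportWithoutR/WithoutH` and the hypothesis `DiagonalClass`).
-/

namespace Summit.HodgeConjecture.HodgeConjecture.Theorems.TwinTwistorTransport.Negative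

open Literature.AlgebraicGeometry.HodgeTheory Literature.AlgebraicTopology.SingularHomology
open CategoryTheory
open scoped Manifold ContDiff

/-- A square root of `2` in `ℂ`. [folklore] -/
theorem exists_complex_mul_self_eq_two : ∃ c : ℂ, c * c = 2 :=
  ⟨(Real.sqrt 2 : ℂ), by
    rw [← Complex.ofReal_mul, Real.mul_self_sqrt (by norm_num : (0:ℝ) ≤ 2)]
    norm_num⟩

/-- WITHOUT (R) THE CRUX IS THE DIAGONAL.  Hypothesis: the diagonal class acts as the identity
(inlined).  Conclusion: `TwinTwistorTransport` with the clause `∀ y, IsRationalClass y →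
IsRationalClass (Ψ.symm y)` deleted, verbatim otherwise — witnessed by `S″ = S`, `p″ = p`,
`Ψ = c • id`, `c² = 2`. [folklore] -/
theorem withoutR_of_diagonalClass
    (hΔ : ∀ (μ : Literature.AlgebraicGeometry.HodgeTheory.OrientationFamily), μ.HasPoincareDuality → ∀ (S : Literature.AlgebraicGeometry.Motives.SchemeOver ℂ) (hS : (Literature.AlgebraicGeometry.Motives.IsSmoothProjective 2 S ∧ Subsingleton (Literature.AlgebraicGeometry.Motives.structureSheafCohomology S.left 1) ∧ ∃ (A : Literature.AlgebraicGeometry.HodgeTheory.HodgeModel 2 S) (η : Literature.Geometry.Kaehler.MForm 𝓘(ℝ, A.model) A.carrier ℂ 2), Literature.Geometry.Kaehler.IsHolomorphicInCharts η ∧ ∀ x, η x ≠ 0)), ∃ Δ ∈ Literature.AlgebraicGeometry.HodgeTheory.algebraicClasses (CategoryTheory.MonoidalCategoryStruct.tensorObj S S) 2, ∀ x : Literature.AlgebraicGeometry.HodgeTheory.complexBetti S (2 * 1), Literature.AlgebraicGeometry.HodgeTheory.complexGysin μ (Literature.AlgebraicGeometry.Motives.IsSmoothProjective.tensor_holds hS.1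 hS.1) hS.1 (CategoryTheory.SemiCartesianMonoidalCategory.fst S S) (rfl : 2 * 1 + 2 * 2 + 2 * 2 = 2 * 1 + 2 * (2 + 2)) (Literature.AlgebraicTopology.SingularHomology.cupProduct (rfl : 2 * 1 + 2 * 2 = 2 * 1 + 2 * 2) (Literature.AlgebraicGeometry.HodgeTheory.complexBetti.map (CategoryTheory.SemiCartesianMonoidalCategory.snd S S) (2 * 1) x) Δ) = x) :
    ∀ (μ : Literature.AlgebraicGeometry.HodgeTheory.OrientationFamily), μ.HasPoincareDuality → ∀ (S : Literature.AlgebraicGeometry.Motives.SchemeOver ℂ) (hS : (Literature.AlgebraicGeometry.Motives.IsSmoothProjective 2 S ∧ Subsingleton (Literature.AlgebraicGeometry.Motives.structureSheafCohomology S.left 1) ∧ ∃ (A : Literature.AlgebraicGeometry.HodgeTheory.HodgeModel 2 S) (η : Literature.Geometry.Kaehler.MForm 𝓘(ℝ, A.model) A.carrier ℂ 2), Literature.Geometry.Kaehler.IsHolomorphicInCharts η ∧ ∀ x, η x ≠ 0)) (p : Literature.AlgebraicGeometry.HodgeTheory.complexBetti S (2 * 2)), (Literature.AlgebraicGeometry.HodgeTheory.IsIntegralClass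 p ∧ ∀ q : Literature.AlgebraicGeometry.HodgeTheory.complexBetti S (2 * 2), Literature.AlgebraicGeometry.HodgeTheory.IsIntegralClass q → ∃ n : ℤ, q = n • p) → ∃ (S'' : Literature.AlgebraicGeometry.Motives.SchemeOver ℂ) (hS'' : (Literature.AlgebraicGeometry.Motives.IsSmoothProjective 2 S'' ∧ Subsingleton (Literature.AlgebraicGeometry.Motives.structureSheafCohomology S''.left 1) ∧ ∃ (A : Literature.AlgebraicGeometry.HodgeTheory.HodgeModel 2 S'') (η : Literature.Geometry.Kaehler.MForm 𝓘(ℝ, A.model) A.carrier ℂ 2), Literature.Geometry.Kaehler.IsHolomorphicInCharts η ∧ ∀ x, η x ≠ 0)) (p'' : Literature.AlgebraicGeometry.HodgeTheory.complexBetti S'' (2 * 2)), (Literature.AlgebraicGeometry.HodgeTheory.IsIntegralClass p'' ∧ ∀ q : Literature.AlgebraicGeometry.HodgeTheory.complexBetti S'' (2 * 2), Literature.AlgebraicGeometry.HodgeTheory.IsIntegralClass q → ∃ n : ℤ, q = n • p'') ∧ ∃ Ψ : Literature.AlgebraicGeometry.HodgeTheory.complexBetti S'' (2 * 1) ≃ₗ[ℂ]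 Literature.AlgebraicGeometry.HodgeTheory.complexBetti S (2 * 1), (∀ (i j : ℕ) y, Literature.AlgebraicGeometry.HodgeTheory.IsOfHodgeType 2 S (2 * 1) i j y → Literature.AlgebraicGeometry.HodgeTheory.IsOfHodgeType 2 S'' (2 * 1) i j (Ψ.symm y)) ∧ (∀ (u v : Literature.AlgebraicGeometry.HodgeTheory.complexBetti S (2 * 1)) (b : ℂ), Literature.AlgebraicTopology.SingularHomology.cupProduct (rfl : 2 * 1 + 2 * 1 = 2 * 2) u v = ((2 : ℂ) * b) • p → Literature.AlgebraicTopology.SingularHomology.cupProduct (rfl : 2 * 1 + 2 * 1 = 2 * 2) (Ψ.symm u) (Ψ.symm v) = b • p'') ∧ ∃ γ ∈ Literature.AlgebraicGeometry.HodgeTheory.algebraicClasses (CategoryTheory.MonoidalCategoryStruct.tensorObj S S'') 2, ∀ x : Literature.AlgebraicGeometry.HodgeTheory.complexBetti S'' (2 * 1), Ψ x = Literature.AlgebraicGeometry.HodgeTheory.complexGysin μ (Literature.AlgebraicGeometry.Motives.IsSmoothProjective.tensor_holds hS.1 hS''.1) hS.1 (CategoryTheory.SemiCartesianMonoidalCategory.fst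 S S'') (rfl : 2 * 1 + 2 * 2 + 2 * 2 = 2 * 1 + 2 * (2 + 2)) (Literature.AlgebraicTopology.SingularHomology.cupProduct (rfl : 2 * 1 + 2 * 2 = 2 * 1 + 2 * 2) (Literature.AlgebraicGeometry.HodgeTheory.complexBetti.map (CategoryTheory.SemiCartesianMonoidalCategory.snd S S'') (2 * 1) x) γ) := by
  intro μ hμ S hS p hp
  obtain ⟨Δ, hΔmem, hΔact⟩ := hΔ μ hμ S hS
  obtain ⟨c, hc⟩ := exists_complex_mul_self_eq_two
  have hc0 : c ≠ 0 := by
    rintro rfl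
    norm_num at hc
  let Ψ : Literature.AlgebraicGeometry.HodgeTheory.complexBetti S (2 * 1) ≃ₗ[ℂ]
      Literature.AlgebraicGeometry.HodgeTheory.complexBetti S (2 * 1) :=
    LinearEquiv.smulOfNeZero ℂ _ c hc0
  have hΨ : ∀ x, Ψ x = c • x := fun x => rfl
  have hΨs : ∀ y, Ψ.symm y = c⁻¹ • y := fun y => by
    rw [LinearEquiv.symm_apply_eq, hΨ, smul_smul, mul_inv_cancel₀ hc0, one_smul]
  refine ⟨S, hS, p, hp, Ψ, ?_, ?_, ?_⟩
  · intro i j y hy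
    obtain ⟨A, hA⟩ := hy
    refine ⟨A, ?_⟩
    rw [hΨs, map_smul]
    exact Submodule.smul_mem _ _ hA
  · intro u v b huv
    rw [hΨs, hΨs, LinearMap.map_smul₂, map_smul, huv, smul_smul, smul_smul]
    congr 1
    rw [← mul_inv, hc, inv_mul_cancel_left₀ two_ne_zero]
  · refine ⟨c • Δ, Submodule.smul_mem _ _ hΔmem, fun x => ?_⟩
    rw [map_smul, map_smul, hΔact, hΨ]

/-- WITHOUT (H) THE CRUX IS THE DIAGONAL.  Hypothesis: the diagonal class acts as the identity
(inlined).  Conclusion: `TwinTwistorTransport` with the halving clause deleted, verbatim otherwise —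
witnessed by `S″ = S`, `p″ = p`, `Ψ = id`. [folklore] -/
theorem withoutH_of_diagonalClass
    (hΔ : ∀ (μ : Literature.AlgebraicGeometry.HodgeTheory.OrientationFamily), μ.HasPoincareDuality → ∀ (S : Literature.AlgebraicGeometry.Motives.SchemeOver ℂ) (hS : (Literature.AlgebraicGeometry.Motives.IsSmoothProjective 2 S ∧ Subsingleton (Literature.AlgebraicGeometry.Motives.structureSheafCohomology S.left 1) ∧ ∃ (A : Literature.AlgebraicGeometry.HodgeTheory.HodgeModel 2 S) (η : Literature.Geometry.Kaehler.MForm 𝓘(ℝ, A.model) A.carrier ℂ 2), Literature.Geometry.Kaehler.IsHolomorphicInCharts η ∧ ∀ x, η x ≠ 0)), ∃ Δ ∈ Literature.AlgebraicGeometry.HodgeTheory.algebraicClasses (CategoryTheory.MonoidalCategoryStruct.tensorObj S S) 2, ∀ x : Literature.AlgebraicGeometry.HodgeTheory.complexBetti S (2 * 1), Literature.AlgebraicGeometry.HodgeTheory.complexGysin μ (Literature.AlgebraicGeometry.Motives.IsSmoothProjective.tensor_holds hS.1 hS.1) hS.1 (CategoryTheory.SemiCartesianMonoidalCategory.fst S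 S) (rfl : 2 * 1 + 2 * 2 + 2 * 2 = 2 * 1 + 2 * (2 + 2)) (Literature.AlgebraicTopology.SingularHomology.cupProduct (rfl : 2 * 1 + 2 * 2 = 2 * 1 + 2 * 2) (Literature.AlgebraicGeometry.HodgeTheory.complexBetti.map (CategoryTheory.SemiCartesianMonoidalCategory.snd S S) (2 * 1) x) Δ) = x) :
    ∀ (μ : Literature.AlgebraicGeometry.HodgeTheory.OrientationFamily), μ.HasPoincareDuality → ∀ (S : Literature.AlgebraicGeometry.Motives.SchemeOver ℂ) (hS : (Literature.AlgebraicGeometry.Motives.IsSmoothProjective 2 S ∧ Subsingleton (Literature.AlgebraicGeometry.Motives.structureSheafCohomology S.left 1) ∧ ∃ (A : Literature.AlgebraicGeometry.HodgeTheory.HodgeModel 2 S) (η : Literature.Geometry.Kaehler.MForm 𝓘(ℝ, A.model) A.carrier ℂ 2), Literature.Geometry.Kaehler.IsHolomorphicInCharts η ∧ ∀ x, η x ≠ 0)) (p : Literature.AlgebraicGeometry.HodgeTheory.complexBetti S (2 * 2)), (Literature.AlgebraicGeometry.HodgeTheory.IsIntegralClass p ∧ ∀ q : Literature.AlgebraicGeometry.HodgeTheory.complexBetti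 S (2 * 2), Literature.AlgebraicGeometry.HodgeTheory.IsIntegralClass q → ∃ n : ℤ, q = n • p) → ∃ (S'' : Literature.AlgebraicGeometry.Motives.SchemeOver ℂ) (hS'' : (Literature.AlgebraicGeometry.Motives.IsSmoothProjective 2 S'' ∧ Subsingleton (Literature.AlgebraicGeometry.Motives.structureSheafCohomology S''.left 1) ∧ ∃ (A : Literature.AlgebraicGeometry.HodgeTheory.HodgeModel 2 S'') (η : Literature.Geometry.Kaehler.MForm 𝓘(ℝ, A.model) A.carrier ℂ 2), Literature.Geometry.Kaehler.IsHolomorphicInCharts η ∧ ∀ x, η x ≠ 0)) (p'' : Literature.AlgebraicGeometry.HodgeTheory.complexBetti S'' (2 * 2)), (Literature.AlgebraicGeometry.HodgeTheory.IsIntegralClass p'' ∧ ∀ q : Literature.AlgebraicGeometry.HodgeTheory.complexBetti S'' (2 * 2), Literature.AlgebraicGeometry.HodgeTheory.IsIntegralClass q → ∃ n : ℤ, q = n • p'') ∧ ∃ Ψ : Literature.AlgebraicGeometry.HodgeTheory.complexBetti S'' (2 * 1) ≃ₗ[ℂ] Literature.AlgebraicGeometry.HodgeTheory.complexBetti S (2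 * 1), (∀ y, Literature.AlgebraicGeometry.HodgeTheory.IsRationalClass y → Literature.AlgebraicGeometry.HodgeTheory.IsRationalClass (Ψ.symm y)) ∧ (∀ (i j : ℕ) y, Literature.AlgebraicGeometry.HodgeTheory.IsOfHodgeType 2 S (2 * 1) i j y → Literature.AlgebraicGeometry.HodgeTheory.IsOfHodgeType 2 S'' (2 * 1) i j (Ψ.symm y)) ∧ ∃ γ ∈ Literature.AlgebraicGeometry.HodgeTheory.algebraicClasses (CategoryTheory.MonoidalCategoryStruct.tensorObj S S'') 2, ∀ x : Literature.AlgebraicGeometry.HodgeTheory.complexBetti S'' (2 * 1), Ψ x = Literature.AlgebraicGeometry.HodgeTheory.complexGysin μ (Literature.AlgebraicGeometry.Motives.IsSmoothProjective.tensor_holds hS.1 hS''.1) hS.1 (CategoryTheory.SemiCartesianMonoidalCategory.fst S S'') (rfl : 2 * 1 + 2 * 2 + 2 * 2 = 2 * 1 + 2 * (2 + 2)) (Literature.AlgebraicTopology.SingularHomology.cupProduct (rfl : 2 * 1 + 2 * 2 = 2 * 1 + 2 * 2) (Literature.AlgebraicGeometry.HodgeTheory.complexBetti.map (CategoryTheory.SemiCartesianMonoidalCategory.snd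 S S'') (2 * 1) x) γ) := by
  intro μ hμ S hS p hp
  obtain ⟨Δ, hΔmem, hΔact⟩ := hΔ μ hμ S hS
  refine ⟨S, hS, p, hp, LinearEquiv.refl ℂ _, ?_, ?_, ?_⟩
  · intro y hy
    simpa using hy
  · intro i j y hy
    simpa using hy
  · exact ⟨Δ, hΔmem, fun x => (hΔact x).symm⟩

end Summit.HodgeConjecture.HodgeConjecture.Theorems.TwinTwistorTransport.Negative
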